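import Literature.MathematicalPhysics.QuantumFieldTheory.Balaban1983to89.Beta.OneShotTelescope
import Literature.MathematicalPhysics.QuantumFieldTheory.Balaban1983to89.Beta.RemainderChain

/-!
# `Balaban1983to89.Beta.DriftRemainder` — the DRIFT road's remainder slot re-typed in PRINTED TYPE: one-loop drift +
the CONSTANT-FORM remainder bound `|β¹_{k+1}| ≤ r` (row an4's `RemainderChain.RemainderConst`, `r = ε₁·K_rem` from the
printed chain) with `r ≤ b` ⟹ the partial-sums END statements (β sub-cell row BETA-an4, (AF-1)/(C); bookkeeping)

HONEST FRAMING (cell `pub-balaban`, BETA-SPEC, verbatim): discharging `BetaPertH` makes Bałaban's UV stability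
UNCONDITIONAL — a real constructive-QFT result; it is NOT the continuum limit and NOT the Clay problem.  (Gloss 1,
BETA-SPEC v1.8d/v1.9b l. 17–18, GAPS G-ref2-14 (a) / G-ref2-20 (a), verbatim: «UNCONDITIONAL» in [Balaban1989LargeFieldII]
(B16) p. 355's interval-hypothesis sense ONLY (`FlowStepRuns.p355Unconditional_of_partialSums` keeps `hnodes`); the located
leaves G-adv3-2 (left inequality of (0.1)/(2.50), d = 4), G-adv3-1 (U2 transfer of B14 Cor. 3's lower bound) and
`SecondExpLeaf` REMAIN.  Gloss 2, BETA-SPEC v1.9e, beta-ref C-beta-78, BINDING: «unconditional» =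
`Beta.Assembly.EventualForm`-unconditional END statement, NOT «Theorem 2 as printed».  Gloss 3 is a CANDIDATE ONLY
(BETA-SPEC v1.9j §7.15 (R9-iv), NOT blessed by beta-ref, NOT binding): under the proposed road V22 the END-statement grade
would move to the partial-sums END statements of `Beta.Drift` — «unconditional» = `BetaPartialSumsLowerH`-unconditional
END statement, `FlowStepRuns.p355Unconditional_of_partialSums` keeps `hnodes`; never «Theorem 2 as printed», never
continuum/Clay.)  THIS MODULE DISCHARGES NOTHING of the series and asserts NOTHING about Bałaban's β-functions: every
theorem is an implication between HYPOTHESIS SHAPES about an arbitrary family `β : HBeta` split as `β⁰ + β¹`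
(`B12Beta.OneLoopSplit`, the bookkeeping of [Balaban1987RG1] (2.12)–(2.14) p. 268); every declaration is `[folklore]`
real arithmetic or a composition BY NAME of landed modules, all imported untouched.  Value = bookkeeping in printed type
(audit cell `pub-balaban`, β sub-cell, unit `b2b-balaban-beta-an4` gen 5), NOT summit progress.

ABSOLUTE RULE (cell, verbatim): no internally-minted statement may enter as a cited fact; every hypothesis is either
kernel-proved in this package or a verbatim quotation of a PUBLISHED theorem with page reference; the manuscripts under
audit are NOT citable for their own disputed steps.  Nothing below is cited as a fact; the `[cite: …]` tags on theorems
point at the printed CONTEXT of a hypothesis shape, exactly as in `Beta.Drift` / `Beta.RemainderChain`.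

PRINTED CONTEXT (quoted for orientation; nothing of it is used).  [Balaban1987RG1] = [I] (CMP **109** (1987) 249–301)
Theorem 2, p. 259, first sentence, verbatim: «Let d = 4, G = SU(2), and let γ be a sufficiently small positive constant,
then for a sufficiently small positive g there exists a bare coupling constant g₀ = g₀(ε, g) such that the sequence of the
effective coupling constants g_k is contained in the interval ]0, γ], and g_K = g.»  The β-function of the (k+1)-st step
is defined by (1.20)–(1.22), p. 264, and splits along (2.12)–(2.14), p. 268, as `β_{k+1}(g_0,…,g_k) = β⁰_{k+1} +
β¹_{k+1}(g_0,…,g_k)` with `β¹_{k+1}(g_0,…,g_{k−1},0) = 0` ((2.14); tree `B12Beta.OneLoopSplit.vanish`).  p. 264, on the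
functions β_k, verbatim: «uniformly bounded on this interval together with all derivatives» — per k; a bound UNIFORM IN k
on the g_k-derivative is NOT printed (GAPS G-b12-2, G-pv20-3).

WHAT THE TREE HAD (the slot this module re-types).  Every END theorem of the DRIFT road — `Beta.Drift`
(`betaPartialSumsLowerH_of_drift`, `endpointExistence_of_drift`, `p355Unconditional_of_drift`), `Beta.OneShotTelescope`
§2/§5 (the lead's PROPOSED road V22, BETA-SPEC §7.15: `betaPartialSumsLowerH_of_telescope`, `…_of_composedLaw`,
`endpointExistence_of_telescope`), `Beta.Assembly.BoundedForm` (field `af1`), `Beta.Transfer.betaPartialSumsLowerH_of_marginalBounded`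
— consumes the non-Gaussian remainder in the LINEAR / LIPSCHITZ shape (AF-1)
`hAF1 : ∀ k p ∈ HistBox γ₀ k, |β¹_{k+1}(p)| ≤ C_r · p_k` with the box smallness `C_r·γ₀ ≤ b` (resp. `≤ b·log L`).  Row an4's
located finding (cell `BETA/AN4.md` (P1), `BETA/REMAINDER-BETA.md` §0–§4, GAPS G-pv20-3), unchanged: the printed chain
[II] (2.41) → [I] (4.2)–(4.5), (4.35), (4.37) → (5.10) → (1.22) delivers for β¹ only the CONSTANT form
`RemainderChain.RemainderConst S γ r : ∀ k p ∈ ]0,γ]^{k+1}, |β¹_{k+1}(p)| ≤ r` with `r = ε₁·K_rem` — uniform in k and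
in the history, linear in ε₁, NOT O(g_k) (`RemainderChain.Chain.abs_beta1_le`, modulo the printed leaves named there);
the Lipschitz shape would need a k-uniform derivative bound that is not in print.  So, as typed, the drift road asked of
row an4 MORE than print gives (BETA-SPEC §7.15 (d)(ii): «does `Drift`'s (AF-1) shape |β¹| ≤ C_r g_k match B12 (2.14)?» —
(2.14) is the vanishing AT g_k = 0, not a Lipschitz modulus).

WHAT THIS MODULE PROVES ([folklore] arithmetic; §-numbers below).
§1  The window sums under a drift and a ONE-SIDED constant remainder bound: `OneLoopDrift b A β⁰` and
    `−r ≤ β¹_{k+1}(p)` on `]0,γ]`-histories give `(b − r)(n − k) − 2A ≤ Σ_{j∈[k,n)} β_j(g_0,…,g_j)` along every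
    `]0,γ]`-valued coupling sequence (`sum_Ico_beta_ge_of_drift_oneSided`); hence for `r ≤ b` the endpoint hypothesis
    `FlowStepRuns.BetaPartialSumsLowerH (2A) γ β` (`betaPartialSumsLowerH_of_drift_oneSided`), in particular from the
    two-sided constant form `RemainderConst S γ r`, `r ≤ b` (`betaPartialSumsLowerH_of_drift_remainderConst`).  NO box
    smallness `C_r γ ≤ b` is spent: the smallness is `r ≤ b`, i.e. on ε₁ — of the printed TYPE: ε₁ sufficiently small given
    the preceding constants ([II] p. 21 after (2.41), restriction R23; `RemainderChain.exists_eps1_le`; the cell's wording, not a quotation).  Nothing is lost: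
    (AF-1) gives the constant form with `r = C_r γ` (`RemainderChain.remainderConst_of_af1`), so `Beta.Drift`'s theorem is
    the special case (recorded as an `example` after `betaPartialSumsLowerH_of_drift_remainderConst`; no new declaration).
§2  The END statements from drift + constant-form remainder: `endpointExistence_of_drift_remainderConst` ([I] Thm 2 first
    sentence for forward-generated constructions, via `FlowStepRuns.endpointExistence_of_partialSums`),
    `p355Unconditional_of_drift_remainderConst` (the B16 p. 355 reading, via `FlowStepRuns.p355Unconditional_of_partialSums`,
    `hnodes` kept — Gloss 1).
§3  The remainder slot filled by the PRINTED CHAIN: `Chain d μ ν S γ₀ c …` with the printed signs and the ε₁-restriction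
    `ε₁·K_rem ≤ b` (`betaPartialSumsLowerH_of_drift_chain`, `endpointExistence_of_drift_chain`).
§4  Road V22 compositions (`Beta.OneShotTelescope`, PROPOSED not adopted, (R9-i)): telescoping (T1) + the two-sided k = 0
    law (T2), or the print's-shape composed law + `SeparationRate`, with the remainder in constant form and
    `r ≤ b·log L` (resp. `ε₁·K_rem ≤ b·log L` for the chain): `betaPartialSumsLowerH_of_telescope_remainderConst`,
    `endpointExistence_of_telescope_remainderConst`, `betaPartialSumsLowerH_of_composedLaw_remainderConst`,
    `betaPartialSumsLowerH_of_telescope_chain`, `endpointExistence_of_telescope_chain`; the ε₁-restriction at fixed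
    `L ≥ 2` is satisfiable (`exists_eps1_le_log`).  ORDER OF CONSTANTS (cell record `Beta.LargeL` v1.2 header, GAPS
    C-beta-28): K_rem depends on L through the printed constants; on V22 `L` is FIXED (BETA-SPEC §7.15 (b): uniformity along `n = L^k` at fixed `L`), so
    `ε₁·K_rem(L) ≤ b·log L` is one restriction on ε₁ after L — the printed order ([I] Thm 3 p. 264: γ after ε₁).
§5  SEPARATING WITNESS (why the re-typing is not cosmetic): a split family with `β⁰ ≡ b`, `β¹_{k+1}(p) = −r·min(1,(k+1)p_k)`
    satisfies the drift (A = 0), the vanishing (2.14), continuity on every box, and the constant form `|β¹| ≤ r` for ALL k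
    — but (AF-1) with a k-UNIFORM constant FAILS for every `C` (`Witness.not_af1`), while §1 applies (`Witness.partialSums`).
    So the constant-form slot is STRICTLY WEAKER than the Lipschitz slot it replaces, and it is the one print's chain fills.
§6  (v1.1) ON THIS ROAD THE PRINTED-TYPE UPPER BOUND IS NOT AN INDEPENDENT INPUT: a drift bounds every single coefficient,
    `|β⁰_k − b| ≤ 2A` (`abs_beta0_sub_le_of_drift`), so `OneLoopDrift b A β⁰` + `RemainderConst S γ r` give
    `BetaUpperH (b + 2A + r) γ β` (`betaUpperH_of_drift_remainderConst`; one-sided and chain variants; sign `upperConst_nonneg`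
    from `0 < γ₀` and `r ≤ b`) — the §2–§4 ENDs WITHOUT the binders `hup`/`0 ≤ β'` (`endpointExistence_of_drift_remainderConst_cont`,
    `…_of_drift_chain_cont`, `…_of_telescope_remainderConst_cont`, `…_of_telescope_chain_cont`; `p355Unconditional_of_drift_remainderConst_cont`
    with the numeric side condition `b + 2A + r ≤ βup` for the `World`'s constant).  Of the wall's row (D5) only joint continuity (C) stays a
    hypothesis by name on this road; on lower-bound-only roads (no drift hypothesis) an upper bound is NOT implied.
VERSIONS.  v1 p181429 (gen 5).  v1.1 p186633 (gen 13): + §6, additions only.  v1.2 (gen 13): this header's §-list and VERSIONS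
    sentence only; every declaration byte-identical to v1.1.

WHAT IS NOT HERE.  Any claim that Bałaban's β⁰ drifts / telescopes ((T1)/(T2) are V22's located hypotheses, (R9-i));
any discharge of the leaves inside `RemainderChain.Chain` ((4.35)/(4.37)/p. 282/(0.26): GAPS G-B12s-15; (5.1): G-adv2-2;
[II] §2: G-B13-07…11); joint continuity (C) = `BetaContH γ₀ β` stays a hypothesis BY NAME (row an4 reduces it in
`Beta.BetaContinuity` / `Beta.BetaContinuityVolume` / `Beta.HistoryContinuity`); the wall (AF-0)/(M2) of the sub-cell is
untouched; `BetaPertH` itself.  References (CONTEXT ONLY): [I] T. Bałaban, CMP 109 (1987) 249–301, Thm 2 p. 259,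
(1.20)–(1.22) p. 264, (2.12)–(2.14) p. 268, (5.10) p. 293; [II] T. Bałaban, CMP 116 (1988) 1–22, (2.41) p. 21;
[B16] T. Bałaban, CMP 122 (1989) 355–392, p. 355.
-/

namespace Literature.MathematicalPhysics.QuantumFieldTheory.Balaban1983to89.Beta.DriftRemainder

open Literature.MathematicalPhysics.QuantumFieldTheory.Balaban1983to89
open FlowStep FlowStepRuns DagBinding
open Literature.MathematicalPhysics.QuantumFieldTheory.Balaban1983to89.Beta.Drift (OneLoopDrift sum_Ico_ge_of_drift)
open Literature.MathematicalPhysics.QuantumFieldTheory.Balaban1983to89.Beta.RemainderChain (RemainderConst Chain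
  ChainSigns remCoeff remainderConst_of_af1)
open Literature.MathematicalPhysics.QuantumFieldTheory.Balaban1983to89.Beta.OneShotTelescope (oneLoopDrift_of_telescope
  oneLoopDrift_of_composedLaw)
open Literature.MathematicalPhysics.QuantumFieldTheory.Balaban1983to89.Beta.MarginalTelescoping (composedCoeff
  SeparationRate)

/-! ## 1. Drift + a one-sided CONSTANT remainder bound ⟹ bounded-below partial sums -/

/-- **WINDOW SUMS UNDER A DRIFT AND A ONE-SIDED CONSTANT REMAINDER BOUND.**  If `β = β⁰ + β¹`, the one-loop
coefficients drift (`|Σ_{j<k} β⁰_j − b k| ≤ A`) and `−r ≤ β¹_{k+1}(g_0,…,g_k)` on `]0,γ]`-histories, then along every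
`]0,γ]`-valued coupling sequence `(b − r)(n − k) − 2A ≤ Σ_{j∈[k,n)} β_j(g_0,…,g_j)`. [folklore] -/
theorem sum_Ico_beta_ge_of_drift_oneSided {β : HBeta} (S : B12Beta.OneLoopSplit β) {b A r γ : ℝ}
    (hdrift : OneLoopDrift b A S.β0)
    (hlow : ∀ k (p : Fin (k + 1) → ℝ), p ∈ B12Beta.HistBox γ k → -r ≤ S.β1 k p)
    {g : ℕ → ℝ} (hg : ∀ i, 0 < g i ∧ g i ≤ γ) {k n : ℕ} (hkn : k ≤ n) :
    (b - r) * ((n : ℝ) - k) - 2 * A ≤ ∑ j ∈ Finset.Ico k n, β j (prefixOf g j) := by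
  have hstep : ∀ j, S.β0 j - r ≤ β j (prefixOf g j) := fun j => by
    have hp : prefixOf g j ∈ B12Beta.HistBox γ j := fun i => hg i
    have h2 := hlow j _ hp
    rw [S.split j]
    linarith
  have hsum : ∑ j ∈ Finset.Ico k n, (S.β0 j - r) ≤ ∑ j ∈ Finset.Ico k n, β j (prefixOf g j) :=
    Finset.sum_le_sum fun j _ => hstep j
  have hsplit : ∑ j ∈ Finset.Ico k n, (S.β0 j - r) = ∑ j ∈ Finset.Ico k n, S.β0 j - r * ((n : ℝ) - k) := by
    rw [Finset.sum_sub_distrib, Finset.sum_const, Nat.card_Ico, nsmul_eq_mul, Nat.cast_sub hkn]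
    ring
  have hdr := sum_Ico_ge_of_drift hdrift hkn
  nlinarith [hsum, hsplit, hdr]

/-- **(A-ps) FROM THE DRIFT FORM WITH THE REMAINDER IN CONSTANT, ONE-SIDED FORM.**  `β = β⁰ + β¹`, `OneLoopDrift b A β⁰`,
`−r ≤ β¹_{k+1}` on `]0,γ]`-histories for ALL k, and `r ≤ b` give `FlowStepRuns.BetaPartialSumsLowerH (2A) γ β` — the
endpoint hypothesis of `FlowStepRuns` §7; no (AF-1) Lipschitz modulus, no box smallness, no sign of any single `β⁰_{k+1}`.
(For Bałaban's β¹ the bound with `r = ε₁·K_rem` is row an4's printed chain, `RemainderChain.Chain.abs_beta1_le`; the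
drift is V22's located hypothesis.) [cite: Balaban1987RG1, Thm 2 p.259 (first sentence) and (2.12)–(2.14) p.268] -/
theorem betaPartialSumsLowerH_of_drift_oneSided {β : HBeta} (S : B12Beta.OneLoopSplit β) {b A r γ : ℝ}
    (hdrift : OneLoopDrift b A S.β0)
    (hlow : ∀ k (p : Fin (k + 1) → ℝ), p ∈ B12Beta.HistBox γ k → -r ≤ S.β1 k p) (hr : r ≤ b) :
    BetaPartialSumsLowerH (2 * A) γ β := by
  intro g hg k n hkn
  have h := sum_Ico_beta_ge_of_drift_oneSided S hdrift hlow hg hkn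
  have hnk : (0 : ℝ) ≤ (n : ℝ) - k := by
    have : (k : ℝ) ≤ n := by exact_mod_cast hkn
    linarith
  nlinarith [h, hnk, hr]

/-- **(A-ps) FROM THE DRIFT FORM WITH THE TWO-SIDED CONSTANT-FORM REMAINDER** `RemainderConst S γ r` (row an4's shape:
`|β¹_{k+1}| ≤ r` on `]0,γ]^{k+1}`, all k) and `r ≤ b`. [cite: Balaban1987RG1, Thm 2 p.259 (first sentence) and (1.22) p.264] -/
theorem betaPartialSumsLowerH_of_drift_remainderConst {β : HBeta} (S : B12Beta.OneLoopSplit β) {b A r γ : ℝ}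
    (hdrift : OneLoopDrift b A S.β0) (hrem : RemainderConst S γ r) (hr : r ≤ b) :
    BetaPartialSumsLowerH (2 * A) γ β :=
  betaPartialSumsLowerH_of_drift_oneSided S hdrift (fun k p hp => (abs_le.mp (hrem k p hp)).1) hr

/- NOTHING IS LOST (kernel check, not a new declaration — the statement IS `Beta.Drift.betaPartialSumsLowerH_of_drift`):
(AF-1) `|β¹_{k+1}| ≤ C_r g_k` with `C_r γ ≤ b` is the special case `r = C_r γ` of the constant-form slot
(`RemainderChain.remainderConst_of_af1`). -/
example {β : HBeta} (S : B12Beta.OneLoopSplit β) {b A Cr γ : ℝ} (hdrift : OneLoopDrift b A S.β0)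
    (hAF1 : ∀ k (p : Fin (k + 1) → ℝ), p ∈ B12Beta.HistBox γ k → |S.β1 k p| ≤ Cr * p (Fin.last k))
    (hCr : 0 ≤ Cr) (hγ : Cr * γ ≤ b) : BetaPartialSumsLowerH (2 * A) γ β :=
  betaPartialSumsLowerH_of_drift_remainderConst S hdrift (remainderConst_of_af1 S hCr hAF1) hγ

/-- Monotonicity of the constant form in the box: `RemainderConst S γ₀ r` and `γ ≤ γ₀` give `RemainderConst S γ r`.
[folklore] -/
theorem remainderConst_mono {β : HBeta} {S : B12Beta.OneLoopSplit β} {γ γ₀ r : ℝ} (h : RemainderConst S γ₀ r)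
    (hγ : γ ≤ γ₀) : RemainderConst S γ r := fun k p hp => h k p fun i => ⟨(hp i).1, (hp i).2.trans hγ⟩

/-! ## 2. The END statements from drift + constant-form remainder -/

/-- **ENDPOINT EXISTENCE FROM THE DRIFT FORM AND THE CONSTANT-FORM REMAINDER** ([I] Thm 2, first sentence, for
forward-generated constructions): drift, `RemainderConst S γ₀ r` with `r ≤ b`, the printed-type upper bound and joint
continuity (C) — via `FlowStepRuns.endpointExistence_of_partialSums`.  No (AF-1), no rate, no sign of any `β⁰_{k+1}`.
[cite: Balaban1987RG1, Thm 2 p.259 (first sentence)] -/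
theorem endpointExistence_of_drift_remainderConst {C : B12.Construction} {β : HBeta} (hgen : ForwardGenerated C β)
    (S : B12Beta.OneLoopSplit β) {γ₀ b A r β' : ℝ} (hγ₀ : 0 < γ₀) (hdrift : OneLoopDrift b A S.β0)
    (hrem : RemainderConst S γ₀ r) (hr : r ≤ b) (hβ' : 0 ≤ β') (hcont : BetaContH γ₀ β)
    (hup : BetaUpperH β' γ₀ β) : EndpointExistence C :=
  endpointExistence_of_partialSums hgen hγ₀ (by linarith [hdrift.nonneg]) hβ' hcont
    (betaPartialSumsLowerH_of_drift_remainderConst S hdrift hrem hr) hup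

/-- The same with the remainder only ONE-SIDED (`−r ≤ β¹_{k+1}`). [cite: Balaban1987RG1, Thm 2 p.259 (first sentence)] -/
theorem endpointExistence_of_drift_oneSided {C : B12.Construction} {β : HBeta} (hgen : ForwardGenerated C β)
    (S : B12Beta.OneLoopSplit β) {γ₀ b A r β' : ℝ} (hγ₀ : 0 < γ₀) (hdrift : OneLoopDrift b A S.β0)
    (hlow : ∀ k (p : Fin (k + 1) → ℝ), p ∈ B12Beta.HistBox γ₀ k → -r ≤ S.β1 k p) (hr : r ≤ b) (hβ' : 0 ≤ β')
    (hcont : BetaContH γ₀ β) (hup : BetaUpperH β' γ₀ β) : EndpointExistence C :=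
  endpointExistence_of_partialSums hgen hγ₀ (by linarith [hdrift.nonneg]) hβ' hcont
    (betaPartialSumsLowerH_of_drift_oneSided S hdrift hlow hr) hup

/-- **THE p. 355 UNCONDITIONAL READING FROM THE DRIFT FORM AND THE CONSTANT-FORM REMAINDER** (Gloss 1: `hnodes` kept):
`B16.Sect2Unconditional` and (0.1) with a bare coupling for every renormalised `g ≤ g⋆`, from the cell's `World`
bookkeeping, the modelling clauses, drift + `RemainderConst S γ₀ r` + `r ≤ b`, the printed upper bound, continuity, and
`2A·γ² ≤ β₀(2+β₀)` — via `FlowStepRuns.p355Unconditional_of_partialSums`.  Bookkeeping only.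
[cite: Balaban1989LargeFieldII, p.355; Balaban1987RG1, (2.12)–(2.14) p.268] -/
theorem p355Unconditional_of_drift_remainderConst (w : World) (hγw : 0 < w.γ) {γ₀ : ℝ} (hγ₀ : w.γ ≤ γ₀)
    (hβup : 0 ≤ w.βup) (hnodes : ∀ P, Nodes (leaves w P)) {β : HBeta}
    (hgen : ForwardGenerated w.C.toB12 β) (hhalt : HaltsOutside w.C.toB12 β)
    (hcur : CurriesHBeta w.C.toB12 β) (hcont : BetaContH γ₀ β) (hup : BetaUpperH w.βup γ₀ β)
    (S : B12Beta.OneLoopSplit β) {b A r : ℝ} (hdrift : OneLoopDrift b A S.β0) (hrem : RemainderConst S γ₀ r)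
    (hr : r ≤ b) (hMγ : 2 * A * w.γ ^ 2 ≤ w.β₀ * (2 + w.β₀)) :
    B16.Sect2Unconditional w.C ∧
      ∃ Em Ep : ℝ, ∀ m : ℕ, ∃ gstar : ℝ, 0 < gstar ∧ ∀ g : ℝ, 0 < g → g ≤ gstar →
        ∀ K : ℕ, ∃ g0 : ℝ, (w.C ⟨K, m, g0⟩).flow.g K = g ∧
          ∀ k, k ≤ K → ∀ V : (w.C ⟨K, m, g0⟩).Cfg k, B16.UVIneq (w.C ⟨K, m, g0⟩) k V Em Ep :=
  p355Unconditional_of_partialSums w hγw hγ₀ (by linarith [hdrift.nonneg]) hβup hMγ hnodes hgen hhalt hcur hcont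
    (betaPartialSumsLowerH_of_drift_remainderConst S hdrift hrem hr) hup

/-! ## 3. The remainder slot filled by the PRINTED CHAIN (row an4) -/

/-- **(A-ps) FROM THE DRIFT FORM AND THE PRINTED REMAINDER CHAIN**: a `RemainderChain.Chain` with the printed signs gives
`|β¹_{k+1}| ≤ ε₁·K_rem` for all k and all `]0,γ₀]`-histories (`Chain.abs_beta1_le`), so drift + the ε₁-restriction
`ε₁·K_rem ≤ b` give `BetaPartialSumsLowerH (2A) γ₀ β`.  The leaves inside the chain stay located.
[cite: Balaban1988RG2Cluster, (2.41) p.21; Balaban1987RG1, (5.10) p.293 and (1.22) p.264] -/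
theorem betaPartialSumsLowerH_of_drift_chain {d : ℕ} {μ ν : Fin d} {β : HBeta} {S : B12Beta.OneLoopSplit β}
    {γ₀ : ℝ} {c : B13.Consts} {α₂ B₃ c₁ K₀ K₁ b A : ℝ} (R : Chain d μ ν S γ₀ c α₂ B₃ c₁ K₀ K₁)
    (hs : ChainSigns c α₂ B₃ K₀) (hdrift : OneLoopDrift b A S.β0)
    (hε₁ : c.ε₁ * remCoeff d c α₂ B₃ c₁ K₀ K₁ ≤ b) : BetaPartialSumsLowerH (2 * A) γ₀ β :=
  betaPartialSumsLowerH_of_drift_remainderConst S hdrift (R.abs_beta1_le hs) hε₁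

/-- **ENDPOINT EXISTENCE FROM THE DRIFT FORM AND THE PRINTED REMAINDER CHAIN** under `ε₁·K_rem ≤ b`, with the printed-type
upper bound and (C) by name. [cite: Balaban1987RG1, Thm 2 p.259 (first sentence); Balaban1988RG2Cluster, (2.41) p.21] -/
theorem endpointExistence_of_drift_chain {C : B12.Construction} {β : HBeta} (hgen : ForwardGenerated C β)
    {S : B12Beta.OneLoopSplit β} {d : ℕ} {μ ν : Fin d} {c : B13.Consts} {α₂ B₃ c₁ K₀ K₁ γ₀ b A β' : ℝ}
    (R : Chain d μ ν S γ₀ c α₂ B₃ c₁ K₀ K₁) (hs : ChainSigns c α₂ B₃ K₀) (hγ₀ : 0 < γ₀)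
    (hdrift : OneLoopDrift b A S.β0) (hε₁ : c.ε₁ * remCoeff d c α₂ B₃ c₁ K₀ K₁ ≤ b) (hβ' : 0 ≤ β')
    (hcont : BetaContH γ₀ β) (hup : BetaUpperH β' γ₀ β) : EndpointExistence C :=
  endpointExistence_of_drift_remainderConst hgen S hγ₀ hdrift (R.abs_beta1_le hs) hε₁ hβ' hcont hup

/-! ## 4. Road V22 (`Beta.OneShotTelescope`, PROPOSED — BETA-SPEC §7.15, (R9-i)) with the remainder in constant form -/

/-- **(A-ps) FROM TELESCOPING WITH THE CONSTANT-FORM REMAINDER.**  (T1) `Σ_{j<k} β⁰_j = B(L^k)` (`L ≥ 2`), (T2)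
`|B(n) − b log n| ≤ A` (`n ≥ 2`), `RemainderConst S γ₀ r` and `r ≤ b·log L` ⟹ `BetaPartialSumsLowerH (2A) γ₀ β`.
(T1)/(T2) are V22's located hypotheses; the remainder slot is row an4's printed-type shape. [folklore] -/
theorem betaPartialSumsLowerH_of_telescope_remainderConst {β : HBeta} (S : B12Beta.OneLoopSplit β) {B : ℕ → ℝ}
    {L : ℕ} {b A r γ₀ : ℝ} (hL : 2 ≤ L) (hA : 0 ≤ A)
    (hTel : ∀ k : ℕ, ∑ j ∈ Finset.range k, S.β0 j = B (L ^ k))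
    (hB : ∀ n : ℕ, 2 ≤ n → |B n - b * Real.log n| ≤ A) (hrem : RemainderConst S γ₀ r)
    (hr : r ≤ b * Real.log L) : BetaPartialSumsLowerH (2 * A) γ₀ β :=
  betaPartialSumsLowerH_of_drift_remainderConst S (oneLoopDrift_of_telescope hL hA hTel hB) hrem hr

/-- **ENDPOINT EXISTENCE FROM TELESCOPING WITH THE CONSTANT-FORM REMAINDER** ((T1) + (T2) + `RemainderConst`, `r ≤ b log L`,
printed-type upper bound, (C)). [cite: Balaban1987RG1, Thm 2 p.259 (first sentence)] -/
theorem endpointExistence_of_telescope_remainderConst {C : B12.Construction} {β : HBeta} (hgen : ForwardGenerated C β)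
    (S : B12Beta.OneLoopSplit β) {B : ℕ → ℝ} {L : ℕ} {γ₀ b A r β' : ℝ} (hγ₀ : 0 < γ₀) (hL : 2 ≤ L) (hA : 0 ≤ A)
    (hTel : ∀ k : ℕ, ∑ j ∈ Finset.range k, S.β0 j = B (L ^ k))
    (hB : ∀ n : ℕ, 2 ≤ n → |B n - b * Real.log n| ≤ A) (hrem : RemainderConst S γ₀ r)
    (hr : r ≤ b * Real.log L) (hβ' : 0 ≤ β') (hcont : BetaContH γ₀ β) (hup : BetaUpperH β' γ₀ β) :
    EndpointExistence C :=
  endpointExistence_of_drift_remainderConst hgen S hγ₀ (oneLoopDrift_of_telescope hL hA hTel hB) hrem hr hβ' hcont hup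

/-- **(A-ps) IN THE PRINT'S SHAPE WITH THE CONSTANT-FORM REMAINDER**: `SeparationRate C θ μ β⁰` + the two-sided composed
law along the powers + `RemainderConst S γ₀ r` with `r ≤ b·log L` ⟹ `BetaPartialSumsLowerH (2(A + Cθ/(1−θ))) γ₀ β`
(`OneShotTelescope.oneLoopDrift_of_composedLaw` ∘ §1). [folklore] -/
theorem betaPartialSumsLowerH_of_composedLaw_remainderConst {β : HBeta} (S : B12Beta.OneLoopSplit β) {μ : ℕ → ℕ → ℝ}
    {L : ℕ} {b A C θ r γ₀ : ℝ} (hC : 0 ≤ C) (hθ0 : 0 ≤ θ) (hθ1 : θ < 1) (hsep : SeparationRate C θ μ S.β0)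
    (hBm : ∀ m : ℕ, |composedCoeff μ m - b * Real.log L * m| ≤ A) (hrem : RemainderConst S γ₀ r)
    (hr : r ≤ b * Real.log L) : BetaPartialSumsLowerH (2 * (A + C * θ / (1 - θ))) γ₀ β :=
  betaPartialSumsLowerH_of_drift_remainderConst S (oneLoopDrift_of_composedLaw hC hθ0 hθ1 hsep hBm) hrem hr

/-- **(A-ps) FROM TELESCOPING WITH THE PRINTED REMAINDER CHAIN** under the ε₁-restriction `ε₁·K_rem ≤ b·log L`.
[cite: Balaban1988RG2Cluster, (2.41) p.21; Balaban1987RG1, (5.10) p.293 and (1.22) p.264] -/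
theorem betaPartialSumsLowerH_of_telescope_chain {d : ℕ} {μ ν : Fin d} {β : HBeta} {S : B12Beta.OneLoopSplit β}
    {γ₀ : ℝ} {c : B13.Consts} {α₂ B₃ c₁ K₀ K₁ b A : ℝ} {B : ℕ → ℝ} {L : ℕ}
    (R : Chain d μ ν S γ₀ c α₂ B₃ c₁ K₀ K₁) (hs : ChainSigns c α₂ B₃ K₀) (hL : 2 ≤ L) (hA : 0 ≤ A)
    (hTel : ∀ k : ℕ, ∑ j ∈ Finset.range k, S.β0 j = B (L ^ k))
    (hB : ∀ n : ℕ, 2 ≤ n → |B n - b * Real.log n| ≤ A)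
    (hε₁ : c.ε₁ * remCoeff d c α₂ B₃ c₁ K₀ K₁ ≤ b * Real.log L) : BetaPartialSumsLowerH (2 * A) γ₀ β :=
  betaPartialSumsLowerH_of_telescope_remainderConst S hL hA hTel hB (R.abs_beta1_le hs) hε₁

/-- **ENDPOINT EXISTENCE FROM TELESCOPING WITH THE PRINTED REMAINDER CHAIN** (`ε₁·K_rem ≤ b·log L`, printed-type upper
bound, (C)). [cite: Balaban1987RG1, Thm 2 p.259 (first sentence); Balaban1988RG2Cluster, (2.41) p.21] -/
theorem endpointExistence_of_telescope_chain {C : B12.Construction} {β : HBeta} (hgen : ForwardGenerated C β)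
    {S : B12Beta.OneLoopSplit β} {d : ℕ} {μ ν : Fin d} {c : B13.Consts} {α₂ B₃ c₁ K₀ K₁ γ₀ b A β' : ℝ}
    {B : ℕ → ℝ} {L : ℕ} (R : Chain d μ ν S γ₀ c α₂ B₃ c₁ K₀ K₁) (hs : ChainSigns c α₂ B₃ K₀) (hγ₀ : 0 < γ₀)
    (hL : 2 ≤ L) (hA : 0 ≤ A) (hTel : ∀ k : ℕ, ∑ j ∈ Finset.range k, S.β0 j = B (L ^ k))
    (hB : ∀ n : ℕ, 2 ≤ n → |B n - b * Real.log n| ≤ A)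
    (hε₁ : c.ε₁ * remCoeff d c α₂ B₃ c₁ K₀ K₁ ≤ b * Real.log L) (hβ' : 0 ≤ β') (hcont : BetaContH γ₀ β)
    (hup : BetaUpperH β' γ₀ β) : EndpointExistence C :=
  endpointExistence_of_telescope_remainderConst hgen S hγ₀ hL hA hTel hB (R.abs_beta1_le hs) hε₁ hβ' hcont hup

/-- The V22 ε₁-restriction is satisfiable at fixed `L ≥ 2`: for `b > 0` and any `K` there is `ε₁ > 0` with
`ε₁ K ≤ b·log L` (`RemainderChain.exists_eps1_le` at `b·log L > 0`). [folklore] -/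
theorem exists_eps1_le_log (b K : ℝ) (hb : 0 < b) {L : ℕ} (hL : 2 ≤ L) :
    ∃ ε₁ : ℝ, 0 < ε₁ ∧ ε₁ * K ≤ b * Real.log L := by
  have hlog : 0 < Real.log L := Real.log_pos (by exact_mod_cast hL)
  exact RemainderChain.exists_eps1_le (b * Real.log L) K (mul_pos hb hlog)

/-! ## 5. Separating witness: the constant-form slot is STRICTLY weaker than the Lipschitz slot (AF-1) -/

namespace Witness

/-- The witness family: `β_{k+1}(p) = b − r·min(1, (k+1)·p_k)`. [folklore] -/
noncomputable def betaW (b r : ℝ) : HBeta := fun k p => b - r * min 1 ((k + 1 : ℝ) * p (Fin.last k))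

/-- Its split: `β⁰ ≡ b`, `β¹_{k+1}(p) = −r·min(1,(k+1)p_k)` — vanishing at `p_k = 0` as (2.14) requires. [folklore] -/
noncomputable def splitW (b r : ℝ) : B12Beta.OneLoopSplit (betaW b r) where
  β0 := fun _ => b
  β1 := fun k p => -(r * min 1 ((k + 1 : ℝ) * p (Fin.last k)))
  split := fun k p => by simp [betaW]; ring
  vanish := fun k p hp => by simp [hp]

/-- The one-loop part drifts with slope `b` and `A = 0`. [folklore] -/
theorem drift (b r : ℝ) : OneLoopDrift b 0 (splitW b r).β0 := fun k => by
  simp only [splitW, Finset.sum_const, Finset.card_range, nsmul_eq_mul]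
  rw [show (k : ℝ) * b - b * k = 0 by ring, abs_zero]

/-- The remainder obeys the CONSTANT form `|β¹_{k+1}| ≤ r` on every `]0,γ]`-box, for all k (`r ≥ 0`). [folklore] -/
theorem remainderConst {b r γ : ℝ} (hr : 0 ≤ r) : RemainderConst (splitW b r) γ r := by
  intro k p hp
  have hpk : 0 < p (Fin.last k) := (hp (Fin.last k)).1
  have hm0 : 0 ≤ min 1 ((k + 1 : ℝ) * p (Fin.last k)) := le_min zero_le_one (by positivity)
  have hm1 : min 1 ((k + 1 : ℝ) * p (Fin.last k)) ≤ 1 := min_le_left _ _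
  show |-(r * min 1 ((k + 1 : ℝ) * p (Fin.last k)))| ≤ r
  rw [abs_neg, abs_of_nonneg (mul_nonneg hr hm0)]
  nlinarith

/-- Each `β_{k+1}` of the witness is continuous (everywhere, hence on every box). [folklore] -/
theorem continuous_betaW (b r : ℝ) (k : ℕ) : Continuous (betaW b r k) := by
  unfold betaW
  fun_prop

/-- **(AF-1) FAILS for the witness with ANY k-uniform constant**: there is no `C` with `|β¹_{k+1}(p)| ≤ C·p_k` on the
`]0,γ]`-histories for all k (`r > 0`, `γ > 0`): at scale k with `p_k = 1/(k+1) ≤ γ` the remainder is `−r` while `C·p_k → 0`.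
[folklore] -/
theorem not_af1 {b r γ : ℝ} (hr : 0 < r) (hγ : 0 < γ) :
    ¬ ∃ C : ℝ, ∀ k (p : Fin (k + 1) → ℝ), p ∈ B12Beta.HistBox γ k →
      |(splitW b r).β1 k p| ≤ C * p (Fin.last k) := by
  rintro ⟨C, hC⟩
  obtain ⟨k, hk⟩ := exists_nat_gt (max (1 / γ) (C / r))
  have hk1 : (0 : ℝ) < k + 1 := by positivity
  have hkγ : 1 / γ < k + 1 := lt_of_le_of_lt (le_max_left _ _) (hk.trans (by linarith))
  have hkC : C / r < k + 1 := lt_of_le_of_lt (le_max_right _ _) (hk.trans (by linarith))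
  set p : Fin (k + 1) → ℝ := fun _ => 1 / (k + 1 : ℝ) with hpdef
  have hp : p ∈ B12Beta.HistBox γ k := fun i => by
    refine ⟨by positivity, ?_⟩
    rw [hpdef, div_le_iff₀ hk1]
    rw [div_lt_iff₀ hγ] at hkγ
    linarith
  have h := hC k p hp
  have hval : (splitW b r).β1 k p = -r := by
    show -(r * min 1 ((k + 1 : ℝ) * (1 / (k + 1 : ℝ)))) = -r
    rw [mul_one_div_cancel hk1.ne', min_self, mul_one]
  rw [hval, abs_neg, abs_of_pos hr] at h
  have hCp : C * p (Fin.last k) = C / (k + 1 : ℝ) := by rw [hpdef]; ring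
  rw [hCp] at h
  rw [div_lt_iff₀ hr] at hkC
  rw [le_div_iff₀ hk1] at h
  nlinarith

/-- … while §1 applies to the witness: drift (`A = 0`) + constant form + `r ≤ b` give partial sums bounded below by `0`.
[folklore] -/
theorem partialSums {b r γ : ℝ} (hr0 : 0 ≤ r) (hr : r ≤ b) : BetaPartialSumsLowerH (2 * 0) γ (betaW b r) :=
  betaPartialSumsLowerH_of_drift_remainderConst (splitW b r) (drift b r) (remainderConst hr0) hr

end Witness

/-! ## 6. (v1.1, additions only) On the drift road the printed-type UPPER BOUND is not an independent input

On the drift + constant-form road of §§1–4 the END binder `hup : BetaUpperH β' γ₀ β` of §2 (and its sign `0 ≤ β'`) is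
DERIVABLE from the two binders already present, by elementary arithmetic: a drift hypothesis controls every SINGLE
one-loop coefficient, `|β⁰_k − b| ≤ 2A` (the window `[k,k+1)` of `Drift.abs_sum_Ico_sub_le_of_drift`), and
`RemainderConst S γ₀ r` is two-sided by definition, so `β_{k+1} = β⁰_{k+1} + β¹_{k+1} ≤ b + 2A + r` on every
`]0,γ₀]`-history; and `0 ≤ b + 2A + r` because a non-empty box forces `0 ≤ r`, the ENDs assume `r ≤ b`, and a drift
forces `0 ≤ A`.  Consequently every END of §§2–4 has a variant WITHOUT `hup`/`hβ'` (suffix `_cont`: of the wall's row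
(D5) "(C) + printed-type upper bound" only joint continuity `BetaContH γ₀ β` remains a hypothesis by name on this road);
in the p. 355 reading the `World`'s bookkeeping constant `w.βup` is met by the numeric side condition `b + 2A + r ≤ βup`.
Bookkeeping only; nothing of the series is asserted; §§1–5 are unchanged. -/

/-- A drift hypothesis bounds every single one-loop coefficient: `|β⁰_k − b| ≤ 2A` (window `[k,k+1)`). [folklore] -/
theorem abs_beta0_sub_le_of_drift {b A : ℝ} {β0 : ℕ → ℝ} (h : OneLoopDrift b A β0) (k : ℕ) :
    |β0 k - b| ≤ 2 * A := by
  have h1 := abs_le.mp (h (k + 1))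
  have h0 := abs_le.mp (h k)
  rw [Finset.sum_range_succ] at h1
  push_cast at h1
  rw [mul_add, mul_one] at h1
  rw [abs_le]
  constructor <;> linarith [h1.1, h1.2, h0.1, h0.2]

/-- The constant form on a NON-EMPTY box (`0 < γ`) forces `0 ≤ r` (test the history `(γ)` at scale 0). [folklore] -/
theorem remainderConst_nonneg {β : HBeta} {S : B12Beta.OneLoopSplit β} {γ r : ℝ} (h : RemainderConst S γ r)
    (hγ : 0 < γ) : 0 ≤ r :=
  (abs_nonneg _).trans (h 0 (fun _ => γ) fun _ => ⟨hγ, le_rfl⟩)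

/-- **THE PRINTED-TYPE UPPER BOUND FROM DRIFT + A ONE-SIDED CONSTANT REMAINDER BOUND**: `OneLoopDrift b A β⁰` and
`β¹_{k+1} ≤ r` on the `]0,γ]`-histories (all k) give `BetaUpperH (b + 2A + r) γ β`. [folklore] -/
theorem betaUpperH_of_drift_oneSided {β : HBeta} (S : B12Beta.OneLoopSplit β) {b A r γ : ℝ}
    (hdrift : OneLoopDrift b A S.β0)
    (hhi : ∀ k (p : Fin (k + 1) → ℝ), p ∈ B12Beta.HistBox γ k → S.β1 k p ≤ r) :
    BetaUpperH (b + 2 * A + r) γ β := by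
  intro k v hv
  have h1 := hhi k v (histBox_of_mem_box hv)
  have h0 := (abs_le.mp (abs_beta0_sub_le_of_drift hdrift k)).2
  rw [S.split k]
  linarith

/-- **THE PRINTED-TYPE UPPER BOUND FROM DRIFT + THE CONSTANT-FORM REMAINDER** (row an4's shape): `OneLoopDrift b A β⁰`
and `RemainderConst S γ r` give `BetaUpperH (b + 2A + r) γ β` — the binder `hup` of §2 is not an independent input on
this road. [cite: Balaban1987RG1, (1.22) p.264 and (2.12)–(2.14) p.268] -/
theorem betaUpperH_of_drift_remainderConst {β : HBeta} (S : B12Beta.OneLoopSplit β) {b A r γ : ℝ}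
    (hdrift : OneLoopDrift b A S.β0) (hrem : RemainderConst S γ r) : BetaUpperH (b + 2 * A + r) γ β :=
  betaUpperH_of_drift_oneSided S hdrift fun k p hp => (abs_le.mp (hrem k p hp)).2

/-- … and from the PRINTED REMAINDER CHAIN with the printed signs: `BetaUpperH (b + 2A + ε₁·K_rem) γ₀ β`.
[cite: Balaban1988RG2Cluster, (2.41) p.21; Balaban1987RG1, (5.10) p.293] -/
theorem betaUpperH_of_drift_chain {d : ℕ} {μ ν : Fin d} {β : HBeta} {S : B12Beta.OneLoopSplit β} {γ₀ : ℝ}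
    {c : B13.Consts} {α₂ B₃ c₁ K₀ K₁ b A : ℝ} (R : Chain d μ ν S γ₀ c α₂ B₃ c₁ K₀ K₁) (hs : ChainSigns c α₂ B₃ K₀)
    (hdrift : OneLoopDrift b A S.β0) : BetaUpperH (b + 2 * A + c.ε₁ * remCoeff d c α₂ B₃ c₁ K₀ K₁) γ₀ β :=
  betaUpperH_of_drift_remainderConst S hdrift (R.abs_beta1_le hs)

/-- The sign of the derived upper constant: `0 < γ₀`, `RemainderConst S γ₀ r`, `r ≤ b` and a drift give
`0 ≤ b + 2A + r`. [folklore] -/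
theorem upperConst_nonneg {β : HBeta} {S : B12Beta.OneLoopSplit β} {γ₀ b A r : ℝ} (hγ₀ : 0 < γ₀)
    (hdrift : OneLoopDrift b A S.β0) (hrem : RemainderConst S γ₀ r) (hr : r ≤ b) : 0 ≤ b + 2 * A + r := by
  have hr0 := remainderConst_nonneg hrem hγ₀
  linarith [hdrift.nonneg]

/-- **ENDPOINT EXISTENCE FROM DRIFT + CONSTANT-FORM REMAINDER + JOINT CONTINUITY ONLY** ([I] Thm 2, first sentence,
forward-generated constructions): §2's `endpointExistence_of_drift_remainderConst` with the upper-bound binder and its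
sign DERIVED (`betaUpperH_of_drift_remainderConst`, `upperConst_nonneg`).  Of the wall's row (D5) only (C) =
`BetaContH γ₀ β` remains by name. [cite: Balaban1987RG1, Thm 2 p.259 (first sentence)] -/
theorem endpointExistence_of_drift_remainderConst_cont {C : B12.Construction} {β : HBeta}
    (hgen : ForwardGenerated C β) (S : B12Beta.OneLoopSplit β) {γ₀ b A r : ℝ} (hγ₀ : 0 < γ₀)
    (hdrift : OneLoopDrift b A S.β0) (hrem : RemainderConst S γ₀ r) (hr : r ≤ b) (hcont : BetaContH γ₀ β) :
    EndpointExistence C :=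
  endpointExistence_of_drift_remainderConst hgen S hγ₀ hdrift hrem hr (upperConst_nonneg hγ₀ hdrift hrem hr) hcont
    (betaUpperH_of_drift_remainderConst S hdrift hrem)

/-- **ENDPOINT EXISTENCE FROM DRIFT + THE PRINTED REMAINDER CHAIN + (C) ONLY** (`ε₁·K_rem ≤ b`).
[cite: Balaban1987RG1, Thm 2 p.259 (first sentence); Balaban1988RG2Cluster, (2.41) p.21] -/
theorem endpointExistence_of_drift_chain_cont {C : B12.Construction} {β : HBeta} (hgen : ForwardGenerated C β)
    {S : B12Beta.OneLoopSplit β} {d : ℕ} {μ ν : Fin d} {c : B13.Consts} {α₂ B₃ c₁ K₀ K₁ γ₀ b A : ℝ}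
    (R : Chain d μ ν S γ₀ c α₂ B₃ c₁ K₀ K₁) (hs : ChainSigns c α₂ B₃ K₀) (hγ₀ : 0 < γ₀)
    (hdrift : OneLoopDrift b A S.β0) (hε₁ : c.ε₁ * remCoeff d c α₂ B₃ c₁ K₀ K₁ ≤ b) (hcont : BetaContH γ₀ β) :
    EndpointExistence C :=
  endpointExistence_of_drift_remainderConst_cont hgen S hγ₀ hdrift (R.abs_beta1_le hs) hε₁ hcont

/-- **ENDPOINT EXISTENCE FROM TELESCOPING (V22) + CONSTANT-FORM REMAINDER + (C) ONLY** ((T1), (T2), `RemainderConst`,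
`r ≤ b log L`). [cite: Balaban1987RG1, Thm 2 p.259 (first sentence)] -/
theorem endpointExistence_of_telescope_remainderConst_cont {C : B12.Construction} {β : HBeta}
    (hgen : ForwardGenerated C β) (S : B12Beta.OneLoopSplit β) {B : ℕ → ℝ} {L : ℕ} {γ₀ b A r : ℝ} (hγ₀ : 0 < γ₀)
    (hL : 2 ≤ L) (hA : 0 ≤ A) (hTel : ∀ k : ℕ, ∑ j ∈ Finset.range k, S.β0 j = B (L ^ k))
    (hB : ∀ n : ℕ, 2 ≤ n → |B n - b * Real.log n| ≤ A) (hrem : RemainderConst S γ₀ r)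
    (hr : r ≤ b * Real.log L) (hcont : BetaContH γ₀ β) : EndpointExistence C :=
  endpointExistence_of_drift_remainderConst_cont hgen S hγ₀ (oneLoopDrift_of_telescope hL hA hTel hB) hrem hr hcont

/-- **ENDPOINT EXISTENCE FROM TELESCOPING (V22) + THE PRINTED REMAINDER CHAIN + (C) ONLY** (`ε₁·K_rem ≤ b·log L`).
[cite: Balaban1987RG1, Thm 2 p.259 (first sentence); Balaban1988RG2Cluster, (2.41) p.21] -/
theorem endpointExistence_of_telescope_chain_cont {C : B12.Construction} {β : HBeta} (hgen : ForwardGenerated C β)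
    {S : B12Beta.OneLoopSplit β} {d : ℕ} {μ ν : Fin d} {c : B13.Consts} {α₂ B₃ c₁ K₀ K₁ γ₀ b A : ℝ}
    {B : ℕ → ℝ} {L : ℕ} (R : Chain d μ ν S γ₀ c α₂ B₃ c₁ K₀ K₁) (hs : ChainSigns c α₂ B₃ K₀) (hγ₀ : 0 < γ₀)
    (hL : 2 ≤ L) (hA : 0 ≤ A) (hTel : ∀ k : ℕ, ∑ j ∈ Finset.range k, S.β0 j = B (L ^ k))
    (hB : ∀ n : ℕ, 2 ≤ n → |B n - b * Real.log n| ≤ A)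
    (hε₁ : c.ε₁ * remCoeff d c α₂ B₃ c₁ K₀ K₁ ≤ b * Real.log L) (hcont : BetaContH γ₀ β) : EndpointExistence C :=
  endpointExistence_of_telescope_remainderConst_cont hgen S hγ₀ hL hA hTel hB (R.abs_beta1_le hs) hε₁ hcont

/-- **THE p. 355 UNCONDITIONAL READING FROM DRIFT + CONSTANT-FORM REMAINDER + (C)**, the `World`'s upper constant met
by the numeric side condition `b + 2A + r ≤ βup` instead of the binders `hup : BetaUpperH w.βup γ₀ β`, `0 ≤ w.βup` of
§2's `p355Unconditional_of_drift_remainderConst` (monotonicity of `BetaUpperH` in the constant).  Bookkeeping only.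
[cite: Balaban1989LargeFieldII, p.355; Balaban1987RG1, (2.12)–(2.14) p.268] -/
theorem p355Unconditional_of_drift_remainderConst_cont (w : World) (hγw : 0 < w.γ) {γ₀ : ℝ} (hγ₀ : w.γ ≤ γ₀)
    (hnodes : ∀ P, Nodes (leaves w P)) {β : HBeta} (hgen : ForwardGenerated w.C.toB12 β)
    (hhalt : HaltsOutside w.C.toB12 β) (hcur : CurriesHBeta w.C.toB12 β) (hcont : BetaContH γ₀ β)
    (S : B12Beta.OneLoopSplit β) {b A r : ℝ} (hdrift : OneLoopDrift b A S.β0) (hrem : RemainderConst S γ₀ r)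
    (hr : r ≤ b) (hwup : b + 2 * A + r ≤ w.βup) (hMγ : 2 * A * w.γ ^ 2 ≤ w.β₀ * (2 + w.β₀)) :
    B16.Sect2Unconditional w.C ∧
      ∃ Em Ep : ℝ, ∀ m : ℕ, ∃ gstar : ℝ, 0 < gstar ∧ ∀ g : ℝ, 0 < g → g ≤ gstar →
        ∀ K : ℕ, ∃ g0 : ℝ, (w.C ⟨K, m, g0⟩).flow.g K = g ∧
          ∀ k, k ≤ K → ∀ V : (w.C ⟨K, m, g0⟩).Cfg k, B16.UVIneq (w.C ⟨K, m, g0⟩) k V Em Ep :=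
  have h0 : 0 ≤ b + 2 * A + r := upperConst_nonneg (lt_of_lt_of_le hγw hγ₀) hdrift hrem hr
  p355Unconditional_of_drift_remainderConst w hγw hγ₀ (h0.trans hwup) hnodes hgen hhalt hcur hcont
    (fun k v hv => (betaUpperH_of_drift_remainderConst S hdrift hrem k v hv).trans hwup) S hdrift hrem hr hMγ

/-- The §5 witness read through §6: drift (`A = 0`) + constant form give it the upper bound `b + 2·0 + r` on every box
(`r ≥ 0`) — and, with `r ≤ b` and continuity, every END of this section applies to it with NO upper-bound input.
[folklore] -/
theorem Witness.upper {b r γ : ℝ} (hr : 0 ≤ r) : BetaUpperH (b + 2 * 0 + r) γ (Witness.betaW b r) :=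
  betaUpperH_of_drift_remainderConst (Witness.splitW b r) (Witness.drift b r) (Witness.remainderConst hr)

end Literature.MathematicalPhysics.QuantumFieldTheory.Balaban1983to89.Beta.DriftRemainder
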